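import Literature.NumberTheory.Automorphic.ShimuraCurveIntegralFormLowerBound
import Literature.NumberTheory.Automorphic.ShimuraCurveDataExistence
import Literature.NumberTheory.Automorphic.ShimuraCurveRibetTakahashiNumeratorProofs
import Literature.NumberTheory.Automorphic.ShimuraCurveRibetTakahashiOptimalProofs
import Literature.NumberTheory.Automorphic.ShimuraCurveRibetTakahashiPeterssonFreyHellegouarchProofs
import Literature.NumberTheory.DiophantineGeometry.PastenValuationProductsAdmissible
import Literature.NumberTheory.DiophantineGeometry.AbcValuationProductSerreFreyProofs
import Literature.NumberTheory.EllipticCurves.IsogenyCompProofs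
import Literature.NumberTheory.EllipticCurves.IsogenyDualInseparableProofs
import Literature.NumberTheory.Sieve.DivisorBound
import HarnessLib

/-!
# Pasten's Theorem 16.4 from the Shimura-curve engine: `pastenShimura2024_thm_16_4` is a theorem
# over the named facts of `ShimuraCurveRibetTakahashi.lean` and Theorem 14.1

Topic `Literature/NumberTheory/DiophantineGeometry`; a proofs-only companion (theorems only: no
definitions, no named facts, D-0026) of `PastenValuationProductsAdmissible.lean`, whose named fact
`pastenShimura2024_thm_16_4` — H. Pasten, *Shimura curves and the abc conjecture*, J. Number Theory
254 (2024) = arXiv:1705.09251v4 [`PastenShimura2024`], **Theorem 16.4** p. 50 (for `ε > 0`, `E/ℚ`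
of conductor `N ≫_ε 1`, `N = DM` admissible, (i) `E` semi-stable and `M` not prime or (ii) `E`
Frey–Hellegouarch and `M` divisible by two odd primes: `∏_{p∣D} v_p(Δ_E) < N^{8/3+ε} M`) — is the
ONE cite-only input under the `abc` bound `pasten2024_thm_2_5` (`d(abc) ≪_ε rad(abc)^{8/3+ε}`,
`AbcValuationProductSerreFreyProofs.lean`), the typed rung of the candidate column A1′ of LADDER-ABC.
Here it is PROVED from the engine of §16, i.e. from the named facts that the summit-side package
`jlPackage_printedClass_of_facts` (`Summits/ABC/ABC/Theorems/RibetTakahashiSplitManyPrimeValuationProductJLPackagePrintedClass.lean`,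
route `RibetTakahashiSplit`) already consumes, plus the one input that package leaves open:

* `hJL : nonempty_shimuraParametrizationData` — Jacquet–Langlands parametrisations
  `X₀^D(M) → A_{D,M} ∼ E` (§2 p. 12, §4.10–4.11; parked on the Modularity theorem);
* `hFrey : ShimuraParametrizationData.normSq_form_eq_deg_mul_covolume` — Frey's identity
  `‖φ^•du‖² = deg φ · covol Λ` on the Shimura curve ((EqFreyQuaternionic) p. 49);
* `h61 : PastenShimura2024_thm_6_1_b` — the refined Ribet–Takahashi formula, classes (b.1)/(b.2)
  (Thm. 6.1 (b) p. 20; (EqUsingRT) of the proof);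
* `hopt : exists_optimal_modularParametrizationData` — the optimal quotient `q_{1,N} j_N`
  (EQUIVALENT to the Modularity theorem `exists_isNewformOf`,
  `exists_optimal_modularParametrizationData_iff_modularity`);
* `hManin : PastenShimura2024_cor_10_2` — the Manin constant is bounded when additive reduction is
  confined to `S` (Cor. 10.2 p. 33; used with `S = {2}`);
* `hht : abs_neronLatticeHeight_sub_le_of_isIsogenous` — `|h(A) − h(B)| ≤ ½ log 163` in a
  `ℚ`-isogeny class (Faltings' Lemma 5 + Mazur–Kenku; §3 p. 13, Lemma 6.8);
* `h141 : PastenShimura2024_thm_14_1_fDM` — Thm. 14.1 ("integral forms are not too small", p. 44)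
  for `f_{D,M} = Ψ(φ_{D,M}^• ω_A)` with Cor. 5.3's degree sandwich (typed by this seat,
  `ShimuraCurveIntegralFormLowerBound.lean`).

Not needed (relative to the package's eleven): `nonempty_shimuraCurveData` (a THEOREM:
`nonempty_shimuraCurveData_holds`), Shimizu's volume `volume_fd_eq` and the analytic folklore
`shimuraCurve_pet_pos_ae_and_log_integrable` (the package states a normalised inequality with side
conditions for its crux; Thm. 16.4 itself needs neither), Mazur–Kenku's `minimalDegree_le_163_mul`
(print uses Cor. 5.3's `(9 log N)²` instead, carried by `h141`), and the Petersson fact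
`murty_petersson_newform_upper_bound` — replaced by the tree's PROVED printed-strength bound on the
printed class `exists_petersson_le_mul_rpow_of_printedClass'` (Mai–Murty, under `exists_isNewformOf`,
which `hopt` implies: `exists_isNewformOf_of_exists_optimal_modularParametrizationData`).

## The proof (Pasten §16.1 p. 49 run with Thm. 6.1 (b), as §16.2 p. 50 prescribes)

For `D = 1` the product is empty. For `D > 1` take a global minimal model `Wm` of `E`
(`hasGlobalMinimalModel_rat_holds`; conductor, minimal discriminant, semi-stability and the
Frey–Hellegouarch property are invariant), a presentation `X` of `X₀^D(M)`
(`nonempty_shimuraCurveData_holds`), a class-minimal datum `P₀` (`δ_{D,M} = P₀.deg`,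
`exists_isMinimalFor_of_nonempty` on `hJL`), the optimal classical datum `D₀` of `hopt`
(`δ_{1,N} = D₀.deg`, newform `f`, Manin constant `c`, Néron lattice `Λ₀` of `A_{1,N}`), and the datum
`Pφ` of `h141` on a minimal model of `A_{D,M}` (degree `≤ (9 log N)² δ_{D,M}`, lattice `Λ`,
`‖Pφ.form‖² ≥ N^{−(5/3+ν)} M⁻¹`). Then, with `T = ∏_{p∣D} v_p(Δ_E)` and `ω = ω(D)`:
`δ_{D,M} T ≤ a δ_{D,M} T = δ_{1,N} b ≤ κ^ω δ_{1,N}` (Thm. 6.1 (b));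
`‖Pφ.form‖² T = deg(Pφ) covol(Λ) T ≤ (9 log N)² κ^ω δ_{1,N} covol(Λ)` (Frey, Cor. 5.3);
`δ_{1,N} covol(Λ) ≤ 163 δ_{1,N} covol(Λ₀) = 163 · 4π² c² (f,f) ≤ 163 · 4π² 𝓜² C_ν N^{1+ν}` (heights,
Zagier — PROVED `zagier_degree_formula_holds` —, Cor. 10.2 at `S = {2}`, Mai–Murty); hence
`T ≤ N^{5/3+ν} M · 81 (log N)² κ^ω · 163 · 4π² 𝓜² C_ν N^{1+ν}`, and with `(log N)² ≤ 4 N^ν/ν²`,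
`κ^ω ≤ (2^ω)^κ ≤ d(D)^κ ≪ N^ν` (divisor bound) and `ν = ε/8`: `T ≤ K₀ N^{8/3+ε/2} M < N^{8/3+ε} M`
once `N^{ε/2} > K₀`. This is the printed chain ((EqUsingRT)–(EqEndPf) with (b) for (a), and
"the necessary bound for the Manin constant … follows from Corollary 10.2", p. 50) with print's
`O(log log N)` bookkeeping done in power form; the real-number lemmas are adapted from the
summit-side `…JLPackageLemmas.lean` (`real_chain`, `log_chain`), which Literature cannot import.

## Main statement

* `pastenShimura2024_thm_16_4_of_engine (hJL) (hFrey) (h61) (hopt) (hManin) (hht) (h141) :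
  pastenShimura2024_thm_16_4`, and the `abc` corollary's trust base by name:
  `pastenShimura2024_thm_16_4_freyHellegouarch_of_engine` (case (ii), the input of Thm. 16.7);
* `pasten2024_thm_2_5_of_engine_of_prop_15_1` — Pasten's `abc` theorem (`pasten2024_thm_2_5`,
  `d(abc)`-currency rung of the valuation-product column) from the engine and Prop. 15.1, through the
  tree's `pasten2024_thm_2_5_of_pastenShimura2024_thm_16_4_of_prop_15_1`
  (`AbcValuationProductSerreFreyProofs.lean`).

## References

* [PastenShimura2024] H. Pasten, J. Number Theory 254 (2024) = arXiv:1705.09251v4: Thm. 6.1 p. 20,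
  Cor. 5.3 p. 17, Cor. 10.2 p. 33, Thm. 14.1 p. 44, §16.1 proof of Thm. 16.1 p. 49, Thm. 16.4 with
  its proof p. 50.
* [MaiMurty1994] L. Mai, M. R. Murty, Contemp. Math. 166 (the Petersson bound, exponent `3`).
* [ZagierCMB1985] D. Zagier, Canad. Math. Bull. 28 (Frey's identity on `X₀(N)`).
-/

noncomputable section

open Finset
open scoped MatrixGroups

namespace Literature.NumberTheory.DiophantineGeometry

open Literature.NumberTheory.Automorphic
open Literature.NumberTheory.EllipticCurves.ModularForms
open CongruenceSubgroup

/-! ### Elementary bookkeeping -/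

/-- `2^{ω(n)} ≤ d(n)`: every prime-power exponent contributes a factor `≥ 2` to
`d(n) = ∏ (v_p(n) + 1)`. [folklore] -/
private theorem two_pow_card_primeFactors_le_card_divisors {n : ℕ} (hn : n ≠ 0) :
    2 ^ n.primeFactors.card ≤ n.divisors.card := by
  rw [Nat.card_divisors hn]
  calc 2 ^ n.primeFactors.card = ∏ _p ∈ n.primeFactors, 2 := by simp
    _ ≤ ∏ p ∈ n.primeFactors, (n.factorization p + 1) := by
        apply Finset.prod_le_prod (fun _ _ => by norm_num)
        intro p hp
        have : 0 < n.factorization p :=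
          (Nat.prime_of_mem_primeFactors hp).factorization_pos_of_dvd hn
            (Nat.dvd_of_mem_primeFactors hp)
        omega

/-- `κ^{ω(D)} ≤ C_ν^κ N^θ` from the divisor bound `d(D) ≤ C_ν D^{θ/κ}`, `D ≤ N`:
`κ^ω ≤ (2^κ)^ω = (2^ω)^κ ≤ d(D)^κ`. [folklore] -/
private theorem kappa_pow_le {κ D N : ℕ} {C θ : ℝ} (hκ : 1 ≤ κ) (hD : D ≠ 0) (hDN : D ≤ N)
    (hC : 1 ≤ C) (hθ : 0 < θ) (hdiv : (D.divisors.card : ℝ) ≤ C * (D : ℝ) ^ (θ / κ)) :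
    (κ : ℝ) ^ D.primeFactors.card ≤ C ^ κ * (N : ℝ) ^ θ := by
  set ω := D.primeFactors.card
  have h2ω : (2 : ℝ) ^ ω ≤ D.divisors.card := by
    exact_mod_cast two_pow_card_primeFactors_le_card_divisors hD
  have hκ2 : (κ : ℝ) ≤ 2 ^ κ := by exact_mod_cast (Nat.lt_two_pow_self (n := κ)).le
  have hDθ : (D : ℝ) ^ (θ / κ) ≤ (N : ℝ) ^ (θ / κ) :=
    Real.rpow_le_rpow (by positivity) (by exact_mod_cast hDN) (by positivity)
  have h2ω' : (2 : ℝ) ^ ω ≤ C * (N : ℝ) ^ (θ / κ) :=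
    h2ω.trans (hdiv.trans (mul_le_mul_of_nonneg_left hDθ (by linarith)))
  have hκ0 : (κ : ℝ) ≠ 0 := Nat.cast_ne_zero.mpr (by omega)
  calc (κ : ℝ) ^ ω ≤ ((2 : ℝ) ^ κ) ^ ω := pow_le_pow_left₀ (by positivity) hκ2 ω
    _ = ((2 : ℝ) ^ ω) ^ κ := by rw [← pow_mul, ← pow_mul, mul_comm]
    _ ≤ (C * (N : ℝ) ^ (θ / κ)) ^ κ := pow_le_pow_left₀ (by positivity) h2ω' κ
    _ = C ^ κ * (N : ℝ) ^ θ := by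
        rw [mul_pow, ← Real.rpow_natCast ((N : ℝ) ^ (θ / κ)), ← Real.rpow_mul (by positivity)]
        congr 2
        field_simp

/-- `(log x)² ≤ (4/ν²) x^ν` for `x ≥ 1`, `ν > 0` (from `log x ≤ x^{ν/2}/(ν/2)`). [folklore] -/
private theorem log_sq_le {x ν : ℝ} (hx : 1 ≤ x) (hν : 0 < ν) :
    Real.log x ^ 2 ≤ 4 / ν ^ 2 * x ^ ν := by
  have hx0 : 0 ≤ x := zero_le_one.trans hx
  have hlog : 0 ≤ Real.log x := Real.log_nonneg hx
  have h : Real.log x ≤ x ^ (ν / 2) / (ν / 2) := Real.log_le_rpow_div hx0 (half_pos hν)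
  have hsq : Real.log x ^ 2 ≤ (x ^ (ν / 2) / (ν / 2)) ^ 2 := pow_le_pow_left₀ hlog h 2
  have hr : (x ^ (ν / 2)) ^ 2 = x ^ ν := by
    rw [← Real.rpow_natCast, ← Real.rpow_mul hx0]
    congr 1
    push_cast
    ring
  calc Real.log x ^ 2 ≤ (x ^ (ν / 2) / (ν / 2)) ^ 2 := hsq
    _ = 4 / ν ^ 2 * x ^ ν := by
        rw [div_pow, hr]
        field_simp
        ring

/-- A power threshold: `K < N^e` for all `N ≥ N₂(K, e)`. [folklore] -/
private theorem exists_nat_rpow_gt {K e : ℝ} (hK : 0 < K) (he : 0 < e) :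
    ∃ N₂ : ℕ, ∀ N : ℕ, N₂ ≤ N → K < (N : ℝ) ^ e := by
  refine ⟨⌈K ^ (1 / e)⌉₊ + 1, fun N hN => ?_⟩
  have hNK : K ^ (1 / e) < N := by
    have h1 : K ^ (1 / e) ≤ ⌈K ^ (1 / e)⌉₊ := Nat.le_ceil _
    have h2 : ((⌈K ^ (1 / e)⌉₊ + 1 : ℕ) : ℝ) ≤ N := by exact_mod_cast hN
    push_cast at h2
    linarith
  calc K = (K ^ (1 / e)) ^ e := by
        rw [← Real.rpow_mul hK.le, one_div_mul_cancel he.ne', Real.rpow_one]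
    _ < (N : ℝ) ^ e := Real.rpow_lt_rpow (by positivity) hNK he

/-- **The multiplicative chain of the proof of Thm. 16.4, first half** (Thm. 6.1 (b), Cor. 5.3,
Frey's identity): from `a δ T = δ₁ b`, `a ≥ 1`, `b ≤ κ^ω`, `deg φ ≤ L δ`, `S = deg φ · V`:
`S T ≤ L κ^ω (δ₁ V)`. [cite: PastenShimura2024, proof of Thm. 16.1 p. 49 ((EqUsingRT)–(EqRTF))] -/
private theorem chain_normSq_mul {T a b δ δ₁ dφ V S κω L : ℝ}
    (hEq : a * δ * T = δ₁ * b) (ha : 1 ≤ a) (hT : 0 ≤ T) (hδ : 0 < δ) (hb : b ≤ κω)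
    (hδ₁ : 0 ≤ δ₁) (hsand : dφ ≤ L * δ) (hL : 0 ≤ L) (hS : S = dφ * V) (hV : 0 < V) :
    S * T ≤ L * κω * (δ₁ * V) := by
  have h1 : δ * T ≤ δ₁ * κω := by
    have h0 : δ * T ≤ a * δ * T := by
      have : 0 ≤ δ * T := mul_nonneg hδ.le hT
      nlinarith
    calc δ * T ≤ a * δ * T := h0
      _ = δ₁ * b := hEq
      _ ≤ δ₁ * κω := mul_le_mul_of_nonneg_left hb hδ₁
  have h2 : dφ * T ≤ L * (δ * T) := by
    have := mul_le_mul_of_nonneg_right hsand hT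
    linarith
  calc S * T = V * (dφ * T) := by rw [hS]; ring
    _ ≤ V * (L * (δ₁ * κω)) := by
        apply mul_le_mul_of_nonneg_left _ hV.le
        exact h2.trans (mul_le_mul_of_nonneg_left h1 hL)
    _ = L * κω * (δ₁ * V) := by ring

/-- **Second half** (heights in the isogeny class, Zagier's formula, the Manin constant, the
Petersson bound): `δ₁ V ≤ 163 · 4π² 𝓜² X`. [cite: PastenShimura2024, proof of Thm. 16.1 p. 49 ((EqFreyClassical), "2|h(A_{1,N}) − h(A_{D,M})| ≤ log 163", Cor. 10.2)] -/
private theorem chain_deg_mul_covol {δ₁ V V₀ c ff 𝓜 X : ℝ}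
    (hzr : 4 * Real.pi ^ 2 * c ^ 2 * ff = δ₁ * V₀) (hδ₁ : 0 ≤ δ₁) (hVV : V ≤ 163 * V₀)
    (hc : |c| ≤ 𝓜) (hff : 0 ≤ ff) (hffX : ff ≤ X) :
    δ₁ * V ≤ 163 * (4 * Real.pi ^ 2 * 𝓜 ^ 2) * X := by
  have hc2 : c ^ 2 ≤ 𝓜 ^ 2 := sq_le_sq' (abs_le.mp hc).1 (abs_le.mp hc).2
  have h𝓜 : 0 ≤ 𝓜 := (abs_nonneg c).trans hc
  calc δ₁ * V ≤ δ₁ * (163 * V₀) := mul_le_mul_of_nonneg_left hVV hδ₁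
    _ = 163 * (4 * Real.pi ^ 2 * (c ^ 2 * ff)) := by rw [← mul_assoc (4 * Real.pi ^ 2), hzr]; ring
    _ ≤ 163 * (4 * Real.pi ^ 2 * (𝓜 ^ 2 * X)) := by
        have : c ^ 2 * ff ≤ 𝓜 ^ 2 * X := mul_le_mul hc2 hffX hff (by positivity)
        gcongr
    _ = 163 * (4 * Real.pi ^ 2 * 𝓜 ^ 2) * X := by ring

/-! ### Theorem 16.4 from the engine -/

set_option maxHeartbeats 400000 in
/-- **Pasten 2024, Theorem 16.4, PROVED from the Shimura-curve engine**: the named fact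
`pastenShimura2024_thm_16_4` (arXiv:1705.09251v4 Thm. 16.4 p. 50: `ε > 0`, `E/ℚ` of conductor
`N ≫_ε 1`, `N = DM` admissible, (i) `E` semi-stable and `M` not prime, or (ii) `E` Frey–Hellegouarch
and `M` divisible by at least two odd primes ⟹ `∏_{p∣D} v_p(Δ_E) < N^{8/3+ε} M`) follows from the
named facts `nonempty_shimuraParametrizationData` (Jacquet–Langlands),
`ShimuraParametrizationData.normSq_form_eq_deg_mul_covolume` (Frey's identity),
`PastenShimura2024_thm_6_1_b` (Ribet–Takahashi–Pasten), `exists_optimal_modularParametrizationData`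
(⟺ the Modularity theorem), `PastenShimura2024_cor_10_2` (Manin constant),
`abs_neronLatticeHeight_sub_le_of_isIsogenous` (Faltings + Mazur–Kenku) and
`PastenShimura2024_thm_14_1_fDM` (Thm. 14.1 for `f_{D,M}` with Cor. 5.3) — by the printed proof
(§16.1 p. 49 with Thm. 6.1 (b), §16.2 p. 50), Zagier's identity (`zagier_degree_formula_holds`) and
Mai–Murty's Petersson bound (`exists_petersson_le_mul_rpow_of_printedClass'`) being theorems of the
tree. [cite: PastenShimura2024, Thm. 16.4 with its proof p. 50 and the proof of Thm. 16.1 p. 49] -/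
theorem pastenShimura2024_thm_16_4_of_engine
    (hJL : nonempty_shimuraParametrizationData)
    (hFrey : ShimuraParametrizationData.normSq_form_eq_deg_mul_covolume)
    (h61 : PastenShimura2024_thm_6_1_b)
    (hopt : exists_optimal_modularParametrizationData)
    (hManin : PastenShimura2024_cor_10_2)
    (hht : abs_neronLatticeHeight_sub_le_of_isIsogenous)
    (h141 : PastenShimura2024_thm_14_1_fDM) :
    pastenShimura2024_thm_16_4 := by
  intro ε hε
  classical
  -- constants, chosen before the curve
  obtain ⟨κ, hκ1, -, h61⟩ := h61
  obtain ⟨𝓜, hManin⟩ := hManin {2}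
  have hmod : exists_isNewformOf :=
    exists_isNewformOf_of_exists_optimal_modularParametrizationData hopt
  set ν : ℝ := ε / 8 with hνdef
  have hν : 0 < ν := by positivity
  obtain ⟨Cp, hCp, hPet⟩ := exists_petersson_le_mul_rpow_of_printedClass' hmod hν
  obtain ⟨N₁, h141⟩ := h141 ν hν
  have hνκ : 0 < ν / κ := by positivity
  obtain ⟨Cν, hCν1, hCν⟩ := Literature.NumberTheory.Sieve.exists_card_divisors_le_mul_rpow' hνκ
  set 𝓜' : ℝ := max (𝓜 : ℝ) 1 with h𝓜'def
  have h𝓜'1 : 1 ≤ 𝓜' := le_max_right _ _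
  set K₀ : ℝ := Cν ^ κ * (81 * (4 / ν ^ 2)) * (4 * Real.pi ^ 2 * 𝓜' ^ 2) * Cp * 163 with hK₀def
  have hK₀ : 0 < K₀ := by positivity
  obtain ⟨N₂, hN₂⟩ := exists_nat_rpow_gt hK₀ (half_pos hε)
  refine ⟨max (max N₁ 3) N₂, fun W _ hN D M hadm hcls => ?_⟩
  -- the curve
  set N := W.conductorNorm ℤ with hNdef
  have hNpos : 0 < N := W.conductorNorm_pos_holds
  haveI : NeZero N := ⟨hNpos.ne'⟩
  have hN₁ : N₁ ≤ N := le_trans (le_trans (le_max_left _ _) (le_max_left _ _)) hN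
  have hN3 : 3 ≤ N := le_trans (le_trans (le_max_right _ _) (le_max_left _ _)) hN
  have hN₂' : N₂ ≤ N := le_trans (le_max_right _ _) hN
  have hNR : (0 : ℝ) < N := by exact_mod_cast hNpos
  have hN1R : (1 : ℝ) ≤ N := by exact_mod_cast hNpos
  have hMpos : 0 < M := hadm.pos_right
  have hM1R : (1 : ℝ) ≤ M := by exact_mod_cast hMpos
  set T : ℕ := ∏ p ∈ D.primeFactors, (W.minimalDiscriminantNorm ℤ).factorization p with hTdef
  -- the case `D = 1`: empty product
  by_cases hD1 : D = 1
  · have hT : T = 1 := by rw [hTdef, hD1, Nat.primeFactors_one, Finset.prod_empty]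
    rw [hT, Nat.cast_one]
    have h1 : (1 : ℝ) < (N : ℝ) ^ ((8 : ℝ) / 3 + ε) :=
      Real.one_lt_rpow (by exact_mod_cast (show 1 < N by omega)) (by positivity)
    nlinarith
  have hD : 1 < D := lt_of_le_of_ne hadm.pos_left (Ne.symm hD1)
  have hD0 : D ≠ 0 := by omega
  have hDN : D ≤ N := Nat.le_of_dvd hNpos hadm.left_dvd
  -- a globally minimal model
  obtain ⟨C₀, hC₀⟩ := WeierstrassCurve.hasGlobalMinimalModel_rat_holds W
  haveI := hC₀
  set Wm := C₀ • W with hWm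
  have hNeq : Wm.conductorNorm ℤ = N := WeierstrassCurve.conductorNorm_smul_rat W C₀
  have hΔeq : Wm.minimalDiscriminantNorm ℤ = W.minimalDiscriminantNorm ℤ :=
    WeierstrassCurve.minimalDiscriminantNorm_smul_rat W C₀
  -- the printed class, transported to the minimal model
  have hFH : IsFreyHellegouarch W → IsFreyHellegouarch Wm := by
    rintro ⟨a, b, C, ha, hb, hab, hCW⟩
    refine ⟨a, b, C * C₀⁻¹, ha, hb, hab, ?_⟩
    rw [hWm, smul_smul, inv_mul_cancel_right, hCW]
  have hss : W.IsSemistable ℤ → Wm.IsSemistable ℤ := fun h => by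
    rw [WeierstrassCurve.isSemistable_iff_squarefree_conductorNorm, hNeq]
    exact (WeierstrassCurve.isSemistable_iff_squarefree_conductorNorm W).mp h
  have hcls' : (Wm.IsSemistable ℤ ∧ ¬ M.Prime) ∨
      (IsFreyHellegouarch Wm ∧ 2 ≤ (M.primeFactors.erase 2).card) := by
    rcases hcls with ⟨h1, h2⟩ | ⟨h1, h2⟩
    · exact Or.inl ⟨hss h1, h2⟩
    · exact Or.inr ⟨hFH h1, h2⟩
  have hodd : ∀ p : ℕ, p.Prime → p ≠ 2 → ¬ p ^ 2 ∣ Wm.conductorNorm ℤ := by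
    intro p hp hp2
    rcases hcls' with ⟨h1, -⟩ | ⟨h1, -⟩
    · exact not_sq_dvd_conductorNorm_of_isSemistable Wm h1 hp
    · exact not_sq_dvd_conductorNorm_of_isFreyHellegouarch h1 hp hp2
  have hclassW : (∀ p : ℕ, p.Prime → ¬ p ^ 2 ∣ Wm.conductorNorm ℤ) ∨ IsFreyHellegouarch Wm := by
    rcases hcls' with ⟨h1, -⟩ | ⟨h1, -⟩
    · exact Or.inl fun p hp => not_sq_dvd_conductorNorm_of_isSemistable Wm h1 hp
    · exact Or.inr h1
  -- the data
  obtain ⟨X⟩ := nonempty_shimuraCurveData_holds hadm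
  obtain ⟨PW⟩ := hJL hadm X Wm hNeq
  obtain ⟨W₀', hW₀', P₀, hP₀⟩ := ShimuraParametrizationData.exists_isMinimalFor_of_nonempty ⟨PW⟩
  obtain ⟨W₀, hW₀e, hW₀m, D₀, hnew, hiso, hD₀min⟩ := hopt N Wm hNeq
  obtain ⟨WA, hWAe, hWAm, Pφ, hisoA, hsand, hnormA⟩ := h141 hadm hD hN₁ X Wm hNeq
  -- Thm 6.1 (b)
  obtain ⟨a, b, ha, hb, hbκ, hEq⟩ := h61 hadm X Wm hNeq hcls' W₀ D₀ hnew hD₀min W₀' P₀ hP₀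
  rw [hΔeq] at hEq
  -- hEq : D₀.modularDegree * b = a * P₀.deg * T
  have hbκ' : (b : ℝ) ≤ (κ : ℝ) ^ D.primeFactors.card := by
    exact_mod_cast Nat.le_of_dvd (pow_pos (by omega) _) hbκ
  have hTeq : (a : ℝ) * P₀.deg * T = D₀.deg * b := by
    have : ((D₀.modularDegree * b : ℕ) : ℝ) = ((a * P₀.deg * T : ℕ) : ℝ) := by exact_mod_cast hEq
    push_cast at this
    have hmd : (D₀.modularDegree : ℝ) = D₀.deg := rfl
    rw [hmd] at this
    linarith
  -- Cor 5.3's sandwich against `δ_{D,M} = P₀.deg`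
  have hsand' : (Pφ.deg : ℝ) ≤ (9 * Real.log N) ^ 2 * P₀.deg := hsand W₀' P₀ hP₀.1
  -- Frey's identity for `Pφ`
  have hnorm : X.normSq Pφ.form = Pφ.deg * ZLattice.covolume Pφ.L.lattice := hFrey Pφ
  -- Zagier for the optimal datum
  have hz := D₀.zagier_degree_formula_holds
  have hff0 : 0 < (peterssonProduct (Gamma0 N) 2 D₀.f D₀.f).re := hz.peterssonProduct_re_pos
  have hzr : 4 * Real.pi ^ 2 * (D₀.c : ℝ) ^ 2 * (peterssonProduct (Gamma0 N) 2 D₀.f D₀.f).re =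
      D₀.deg * ZLattice.covolume D₀.L.lattice := by
    have := congrArg Complex.re hz
    rwa [Complex.re_ofReal_mul, Complex.ofReal_re] at this
  -- the Manin constant (Cor 10.2 at `S = {2}`)
  have hc : |D₀.maninConstant| ≤ (𝓜 : ℤ) :=
    hManin N W₀ D₀ (fun p hp hpS => hNeq ▸ hodd p hp (by simpa using hpS)) hD₀min
  have hc' : |(D₀.c : ℝ)| ≤ 𝓜' := by
    have h1 : ((|D₀.c| : ℤ) : ℝ) ≤ (𝓜 : ℝ) := by exact_mod_cast hc
    rw [Int.cast_abs] at h1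
    exact h1.trans (le_max_left _ _)
  -- the Petersson bound (Mai–Murty on the printed class)
  have hpet : (peterssonProduct (Gamma0 N) 2 D₀.f D₀.f).re ≤ Cp * (N : ℝ) ^ (1 + ν) :=
    hPet N Wm D₀.f hnew hodd hclassW
  -- heights: `covol Λ ≤ 163 covol Λ₀`
  have hisoA0 : WA.IsIsogenous W₀ := (hisoA.symm_of_isElliptic).trans' hiso
  have hheight := hht WA W₀ Pφ.L D₀.L Pφ.isNeronLattice D₀.isNeronLattice hisoA0
  have hV : 0 < ZLattice.covolume Pφ.L.lattice := ZLattice.covolume_pos _ _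
  have hV₀ : 0 < ZLattice.covolume D₀.L.lattice := ZLattice.covolume_pos _ _
  have hVV : ZLattice.covolume Pφ.L.lattice ≤ 163 * ZLattice.covolume D₀.L.lattice := by
    unfold neronLatticeHeight at hheight
    have h := (abs_le.mp hheight).1
    have hlog : Real.log (ZLattice.covolume Pφ.L.lattice) ≤
        Real.log (ZLattice.covolume D₀.L.lattice) + Real.log 163 := by linarith
    calc ZLattice.covolume Pφ.L.lattice
        = Real.exp (Real.log (ZLattice.covolume Pφ.L.lattice)) := (Real.exp_log hV).symm
      _ ≤ Real.exp (Real.log (ZLattice.covolume D₀.L.lattice) + Real.log 163) :=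
          Real.exp_le_exp.mpr hlog
      _ = 163 * ZLattice.covolume D₀.L.lattice := by
          rw [Real.exp_add, Real.exp_log hV₀, Real.exp_log (by norm_num), mul_comm]
  -- the two halves of the chain
  set S : ℝ := X.normSq Pφ.form with hSdef
  have hST : S * T ≤ (9 * Real.log N) ^ 2 * (κ : ℝ) ^ D.primeFactors.card *
      ((D₀.deg : ℝ) * ZLattice.covolume Pφ.L.lattice) :=
    chain_normSq_mul hTeq (by exact_mod_cast ha) (by positivity) (by exact_mod_cast P₀.deg_pos)
      hbκ' (by positivity) hsand' (by positivity) hnorm hV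
  have hδV : (D₀.deg : ℝ) * ZLattice.covolume Pφ.L.lattice ≤
      163 * (4 * Real.pi ^ 2 * 𝓜' ^ 2) * (Cp * (N : ℝ) ^ (1 + ν)) :=
    chain_deg_mul_covol hzr (by positivity) hVV hc' hff0.le hpet
  -- `log² N` and `κ^ω` in power form
  have hlogsq : (9 * Real.log N) ^ 2 ≤ 81 * (4 / ν ^ 2 * (N : ℝ) ^ ν) := by
    have := log_sq_le hN1R hν
    nlinarith
  have hκω : (κ : ℝ) ^ D.primeFactors.card ≤ Cν ^ κ * (N : ℝ) ^ ν :=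
    kappa_pow_le hκ1 hD0 hDN hCν1 hν (hCν D)
  -- Thm 14.1: `1 ≤ N^{5/3+ν} M S`
  have hS1 : 1 ≤ (N : ℝ) ^ (5 / 3 + ν) * M * S := by
    have h := mul_le_mul_of_nonneg_left hnormA
      (show (0 : ℝ) ≤ (N : ℝ) ^ (5 / 3 + ν) * M by positivity)
    have h1 : (N : ℝ) ^ (5 / 3 + ν) * M * ((N : ℝ) ^ (-(5 / 3 + ν)) * (M : ℝ)⁻¹) = 1 := by
      rw [Real.rpow_neg hNR.le]
      field_simp
    calc (1 : ℝ) = (N : ℝ) ^ (5 / 3 + ν) * M * ((N : ℝ) ^ (-(5 / 3 + ν)) * (M : ℝ)⁻¹) := h1.symm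
      _ ≤ (N : ℝ) ^ (5 / 3 + ν) * M * S := h
  -- assembling
  have hT0 : (0 : ℝ) ≤ T := by positivity
  have hSTb : S * T ≤ (81 * (4 / ν ^ 2 * (N : ℝ) ^ ν)) * (Cν ^ κ * (N : ℝ) ^ ν) *
      (163 * (4 * Real.pi ^ 2 * 𝓜' ^ 2) * (Cp * (N : ℝ) ^ (1 + ν))) := by
    have h0 : 0 ≤ (D₀.deg : ℝ) * ZLattice.covolume Pφ.L.lattice := by positivity
    calc S * T ≤ (9 * Real.log N) ^ 2 * (κ : ℝ) ^ D.primeFactors.card *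
          ((D₀.deg : ℝ) * ZLattice.covolume Pφ.L.lattice) := hST
      _ ≤ (81 * (4 / ν ^ 2 * (N : ℝ) ^ ν)) * (Cν ^ κ * (N : ℝ) ^ ν) *
          (163 * (4 * Real.pi ^ 2 * 𝓜' ^ 2) * (Cp * (N : ℝ) ^ (1 + ν))) := by
          gcongr
  have hpow : (N : ℝ) ^ (5 / 3 + ν) * ((N : ℝ) ^ ν * (N : ℝ) ^ ν * (N : ℝ) ^ (1 + ν)) =
      (N : ℝ) ^ ((8 : ℝ) / 3 + ε / 2) := by
    rw [← Real.rpow_add hNR, ← Real.rpow_add hNR, ← Real.rpow_add hNR]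
    congr 1
    rw [hνdef]
    ring
  have hTle : (T : ℝ) ≤ K₀ * (N : ℝ) ^ ((8 : ℝ) / 3 + ε / 2) * M := by
    calc (T : ℝ) = 1 * T := (one_mul _).symm
      _ ≤ ((N : ℝ) ^ (5 / 3 + ν) * M * S) * T := mul_le_mul_of_nonneg_right hS1 hT0
      _ = (N : ℝ) ^ (5 / 3 + ν) * M * (S * T) := by ring
      _ ≤ (N : ℝ) ^ (5 / 3 + ν) * M * ((81 * (4 / ν ^ 2 * (N : ℝ) ^ ν)) *
          (Cν ^ κ * (N : ℝ) ^ ν) * (163 * (4 * Real.pi ^ 2 * 𝓜' ^ 2) * (Cp * (N : ℝ) ^ (1 + ν)))) :=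
          mul_le_mul_of_nonneg_left hSTb (by positivity)
      _ = K₀ * ((N : ℝ) ^ (5 / 3 + ν) * ((N : ℝ) ^ ν * (N : ℝ) ^ ν * (N : ℝ) ^ (1 + ν))) * M := by
          rw [hK₀def]; ring
      _ = K₀ * (N : ℝ) ^ ((8 : ℝ) / 3 + ε / 2) * M := by rw [hpow]
  have hK₀N : K₀ < (N : ℝ) ^ (ε / 2) := hN₂ N hN₂'
  have hfin : K₀ * (N : ℝ) ^ ((8 : ℝ) / 3 + ε / 2) * M < (N : ℝ) ^ ((8 : ℝ) / 3 + ε) * M := by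
    have hpos : 0 < (N : ℝ) ^ ((8 : ℝ) / 3 + ε / 2) * M := by positivity
    have hsplit : (N : ℝ) ^ ((8 : ℝ) / 3 + ε) = (N : ℝ) ^ (ε / 2) * (N : ℝ) ^ ((8 : ℝ) / 3 + ε / 2) := by
      rw [← Real.rpow_add hNR]; congr 1; ring
    calc K₀ * (N : ℝ) ^ ((8 : ℝ) / 3 + ε / 2) * M = K₀ * ((N : ℝ) ^ ((8 : ℝ) / 3 + ε / 2) * M) := by
          ring
      _ < (N : ℝ) ^ (ε / 2) * ((N : ℝ) ^ ((8 : ℝ) / 3 + ε / 2) * M) :=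
          mul_lt_mul_of_pos_right hK₀N hpos
      _ = (N : ℝ) ^ ((8 : ℝ) / 3 + ε) * M := by rw [hsplit]; ring
  exact hTle.trans_lt hfin

/-- **Theorem 16.4 (ii) — the input of the `abc` bound Thm. 16.7 — from the engine**: the
projection `pastenShimura2024_thm_16_4.freyHellegouarch` fed with the engine facts (so the tree's
`pasten2024_thm_2_5_of_pastenShimura2024_thm_16_4_of_w80Texts` and siblings take these seven names in
place of the cite-only Thm. 16.4). [cite: PastenShimura2024, Thm. 16.4 (ii) p. 50] -/
theorem pastenShimura2024_thm_16_4_freyHellegouarch_of_engine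
    (hJL : nonempty_shimuraParametrizationData)
    (hFrey : ShimuraParametrizationData.normSq_form_eq_deg_mul_covolume)
    (h61 : PastenShimura2024_thm_6_1_b)
    (hopt : exists_optimal_modularParametrizationData)
    (hManin : PastenShimura2024_cor_10_2)
    (hht : abs_neronLatticeHeight_sub_le_of_isIsogenous)
    (h141 : PastenShimura2024_thm_14_1_fDM) :
    ∀ ε : ℝ, 0 < ε → ∃ N₀ : ℕ, ∀ (W : WeierstrassCurve ℚ) [W.IsElliptic],
      IsFreyHellegouarch W → N₀ ≤ W.conductorNorm ℤ →
        ∀ D M : ℕ, IsAdmissibleFactorization (W.conductorNorm ℤ) D M →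
          2 ≤ (M.primeFactors.erase 2).card →
            ((∏ p ∈ D.primeFactors, (W.minimalDiscriminantNorm ℤ).factorization p : ℕ) : ℝ)
              < (W.conductorNorm ℤ : ℝ) ^ ((8 : ℝ) / 3 + ε) * (M : ℝ) :=
  (pastenShimura2024_thm_16_4_of_engine hJL hFrey h61 hopt hManin hht h141).freyHellegouarch

/-- **Pasten's `abc` theorem (arXiv Thm. 16.7 = JNT Thm. 16.8 = `pasten2024_thm_2_5`:
`∏_{p∣abc} v_p(abc) ≤ κ_ε rad(abc)^{8/3+ε}`) over the engine**, with print's remaining input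
Proposition 15.1 (`pastenShimura2024_prop_15_1`, linear forms in `p`-adic logarithms; itself a theorem
relative to `Dioph.evertseGyory_thm_4_2_1_rat`, `pastenShimura2024_prop_15_1_of_evertseGyory`) — the
tree's `pasten2024_thm_2_5_of_pastenShimura2024_thm_16_4_of_prop_15_1` (Lemma 15.2 eliminated by
Serre's arrangement) fed with `pastenShimura2024_thm_16_4_of_engine`. So the typed rung of the
valuation-product column rests on {Jacquet–Langlands, Frey's identity, Thm. 6.1 (b), Modularity,
Cor. 10.2, Faltings–Mazur–Kenku heights, Thm. 14.1 for `f_{D,M}`, Prop. 15.1} by name.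
[cite: PastenShimura2024, Thm. 16.7 with its proof pp. 50–51 (arXiv:1705.09251v4)] -/
theorem pasten2024_thm_2_5_of_engine_of_prop_15_1
    (h151 : pastenShimura2024_prop_15_1)
    (hJL : nonempty_shimuraParametrizationData)
    (hFrey : ShimuraParametrizationData.normSq_form_eq_deg_mul_covolume)
    (h61 : PastenShimura2024_thm_6_1_b)
    (hopt : exists_optimal_modularParametrizationData)
    (hManin : PastenShimura2024_cor_10_2)
    (hht : abs_neronLatticeHeight_sub_le_of_isIsogenous)
    (h141 : PastenShimura2024_thm_14_1_fDM) :
    pasten2024_thm_2_5 :=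
  pasten2024_thm_2_5_of_pastenShimura2024_thm_16_4_of_prop_15_1 h151
    (pastenShimura2024_thm_16_4_of_engine hJL hFrey h61 hopt hManin hht h141)

end Literature.NumberTheory.DiophantineGeometry

end
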